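import Literature.Geometry.Symplectic.PlusOneSpherePairProofs
import Mathlib.Algebra.Polynomial.Roots
import Mathlib.Analysis.Normed.Module.Connected
import Mathlib.LinearAlgebra.Complex.FiniteDimensional
import Mathlib.LinearAlgebra.Matrix.ToLinearEquiv
import Mathlib.Topology.Constructions.SumProd
import Mathlib.Topology.Homotopy.Basic

/-!
# Projective transformations of `ℂℙ¹` are homotopic to the identity; the chart swap
(registered helpers `helper_moebiusHomotopic`, `helper_swapGlued` of line `cross-cap-laurent`,
crux `GromovRecognitionRelEnd`, item stmt-SmoothPoincare4-11009)

Gromov compactness hands the lead limits of *reparametrised* glued maps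
`F ∘ projectiveMap (A k)` of two-chart spheres, `A k ∈ GL₂(ℂ)` acting on the tree's complex
projective line `Literature.Topology.FourManifolds.ComplexProjectiveSpace 1` through
`Literature.Geometry.Symplectic.PlusOneSpherePair.projectiveMap`.  To keep track of homotopy
classes two facts are needed, proved here:

* `helper_moebiusHomotopic`: every projective transformation `[v] ↦ [A v]` of `ℂℙ¹`
  (`A : ℂ² ≃ₗ[ℂ] ℂ²`) is homotopic to the identity, because `GL₂(ℂ)` is path connected.
  Concretely, join `1` to `A` through the complex pencil `B s := s • A + (1 - s) • 1`, `s ∈ ℂ`: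
  the set of `s` for which `B s` is singular is contained in the zero set of the determinant
  `det (B s)`, a polynomial in `s` with constant term `det 1 = 1`, hence finite; the complement
  of a finite subset of `ℂ ≅ ℝ²` is path connected
  (`Set.Countable.isPathConnected_compl_of_one_lt_rank`), so there is a path `γ : [0, 1] → ℂ`
  from `0` to `1` along which `B (γ t)` is injective, and `H (t, [v]) := [B (γ t) v]` is the
  homotopy.  Its joint continuity in `(t, [v])` is checked on `[0, 1] × (ℂ² ∖ {0})`, using that
  `id × mk` is an (open) quotient map since `mk : ℂ² ∖ {0} → ℂℙ¹` is an open quotient map.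
* `helper_swapGlued`: the swap of the two charts of a two-chart sphere `(u, v)` (`v z = u z⁻¹`)
  with glued map `F` (`F [w₀ : w₁] = u (w₁ / w₀)` on `{w₀ ≠ 0}`, `= v (w₀ / w₁)` on `{w₁ ≠ 0}`)
  is realised by the projective transformation `σ [w₀ : w₁] = [w₁ : w₀]` of the coordinate
  swap: `F ∘ σ` is `v (w₁ / w₀)` on `{w₀ ≠ 0}` and `u (w₀ / w₁)` on `{w₁ ≠ 0}` (read `F` in the
  *other* chart at the swapped point), and `σ` is homotopic to the identity by the first fact.

References: P. Griffiths, J. Harris, *Principles of Algebraic Geometry* (1978), Ch. 0 §2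
(projective transformations); D. McDuff, D. Salamon, *J-holomorphic Curves and Symplectic
Topology*, 2nd ed. (2012), §4.2 (spheres as maps of `S² = ℂ ∪ {∞}`; reparametrisations by
`PSL₂(ℂ)`).
-/

noncomputable section

-- the prescribed namespace `Summit.<P>.<Sub>.…` duplicates `SmoothPoincare4` (P = Sub)
set_option linter.dupNamespace false

open scoped Topology
open Set Function
open Literature.Topology.FourManifolds Literature.Topology.FourManifolds.ComplexProjectiveSpace
  Literature.Geometry.Symplectic

namespace Summit.SmoothPoincare4.SmoothPoincare4.Theorems.GromovRecognitionRelEnd.CrossCapLaurent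

namespace MoebiusHomotopic

/-! ### The pencil `s • A + (1 - s) • 1` is singular for finitely many `s` -/

/-- For a linear endomorphism `A` of `ℂ²`, the set of `s ∈ ℂ` for which the pencil
`s • A + (1 - s) • 1` kills a nonzero vector is finite: it is contained in the zero set of the
determinant of the pencil, a polynomial in `s` of degree `≤ 2` with constant term `det 1 = 1`.
[folklore] -/
theorem finite_setOf_pencil_singular (A : (Fin 2 → ℂ) →ₗ[ℂ] (Fin 2 → ℂ)) :
    {s : ℂ | ∃ v : Fin 2 → ℂ, v ≠ 0 ∧
      (s • A + (1 - s) • LinearMap.id : (Fin 2 → ℂ) →ₗ[ℂ] (Fin 2 → ℂ)) v = 0}.Finite := by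
  -- the determinant of the pencil as a polynomial in `s`
  set a : ℂ := A (Pi.single 0 1) 0 with ha
  set b : ℂ := A (Pi.single 1 1) 0 with hb
  set c : ℂ := A (Pi.single 0 1) 1 with hc
  set d : ℂ := A (Pi.single 1 1) 1 with hd
  set P : Polynomial ℂ :=
    (Polynomial.C a * Polynomial.X + (1 - Polynomial.X)) *
        (Polynomial.C d * Polynomial.X + (1 - Polynomial.X)) -
      (Polynomial.C b * Polynomial.X) * (Polynomial.C c * Polynomial.X) with hP
  have hP0 : P.eval 0 = 1 := by simp [hP]
  have hPne : P ≠ 0 := fun h => by simp [h] at hP0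
  refine (Polynomial.finite_setOf_isRoot hPne).subset ?_
  rintro s ⟨v, hv, hsv⟩
  -- the matrix of the pencil at `s` is singular
  have hdet : (LinearMap.toMatrix'
      (s • A + (1 - s) • LinearMap.id : (Fin 2 → ℂ) →ₗ[ℂ] (Fin 2 → ℂ))).det = 0 :=
    Matrix.exists_mulVec_eq_zero_iff.1 ⟨v, hv, by rw [LinearMap.toMatrix'_mulVec, hsv]⟩
  rw [Matrix.det_fin_two] at hdet
  simp only [LinearMap.toMatrix'_apply, LinearMap.add_apply, LinearMap.smul_apply,
    LinearMap.id_apply, Pi.add_apply, Pi.smul_apply, smul_eq_mul] at hdet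
  rw [← ha, ← hb, ← hc, ← hd] at hdet
  show P.IsRoot s
  simp only [hP, Polynomial.IsRoot.def, Polynomial.eval_sub, Polynomial.eval_mul,
    Polynomial.eval_add, Polynomial.eval_C, Polynomial.eval_X, Polynomial.eval_one]
  rw [← hdet]
  simp
  ring

/-- There is a continuous path `γ : [0, 1] → ℂ` from `0` to `1` along which the pencil
`γ t • A + (1 - γ t) • 1` of a linear automorphism `A` of `ℂ²` stays injective: the pencil is
singular only on a finite set not containing `0` (the identity) and `1` (the automorphism `A`),
and the complement of a finite subset of `ℂ ≅ ℝ²` is path connected. [folklore] -/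
theorem exists_path_pencil_ne_zero (A : (Fin 2 → ℂ) ≃ₗ[ℂ] (Fin 2 → ℂ)) :
    ∃ γ : Path (0 : ℂ) 1, ∀ (t : unitInterval) (v : Fin 2 → ℂ), v ≠ 0 →
      ((γ t : ℂ) • (A : (Fin 2 → ℂ) →ₗ[ℂ] (Fin 2 → ℂ)) + (1 - (γ t : ℂ)) • LinearMap.id :
        (Fin 2 → ℂ) →ₗ[ℂ] (Fin 2 → ℂ)) v ≠ 0 := by
  set S : Set ℂ := {s : ℂ | ∃ v : Fin 2 → ℂ, v ≠ 0 ∧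
    (s • (A : (Fin 2 → ℂ) →ₗ[ℂ] (Fin 2 → ℂ)) + (1 - s) • LinearMap.id :
      (Fin 2 → ℂ) →ₗ[ℂ] (Fin 2 → ℂ)) v = 0} with hS
  have hSf : S.Finite := finite_setOf_pencil_singular (A : (Fin 2 → ℂ) →ₗ[ℂ] (Fin 2 → ℂ))
  have hrank : 1 < Module.rank ℝ ℂ :=
    Module.one_lt_rank_of_one_lt_finrank (by rw [Complex.finrank_real_complex]; norm_num)
  have hpc : IsPathConnected Sᶜ := hSf.countable.isPathConnected_compl_of_one_lt_rank hrank
  have h0 : (0 : ℂ) ∈ Sᶜ := by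
    rintro ⟨v, hv, h⟩
    exact hv (by simpa using h)
  have h1 : (1 : ℂ) ∈ Sᶜ := by
    rintro ⟨v, hv, h⟩
    exact hv (by simpa using h)
  obtain ⟨γ, hγ⟩ := hpc.joinedIn 0 h0 1 h1
  exact ⟨γ, fun t v hv h => hγ t ⟨v, hv, h⟩⟩

/-! ### Homotopies of `ℂℙ¹` from paths of injective linear maps -/

/-- `id × mk : [0, 1] × (ℂ² ∖ {0}) → [0, 1] × ℂℙ¹` is an open quotient map (`mk` is a continuous
open surjection, and open quotient maps are stable under products). [folklore] -/
theorem isOpenQuotientMap_prodMap_mk :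
    IsOpenQuotientMap (Prod.map id mk : unitInterval × {v : Fin (1 + 1) → ℂ // v ≠ 0} →
      unitInterval × ComplexProjectiveSpace 1) :=
  IsOpenQuotientMap.id.prodMap ⟨mk_surjective, continuous_mk, isOpenMap_mk⟩

/-- **Homotopy from a path of injective linear maps.**  A family `B t`, `t ∈ [0, 1]`, of
injective linear endomorphisms of `ℂ²`, jointly continuous in `(t, v)`, induces a continuous map
`H : [0, 1] × ℂℙ¹ → ℂℙ¹` with `H (t, [v]) = [B t v]`: continuity is checked after composing
with the quotient map `id × mk`. [folklore] -/
theorem exists_continuous_family_map {B : unitInterval → (Fin 2 → ℂ) →ₗ[ℂ] (Fin 2 → ℂ)}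
    (hB : ∀ (t : unitInterval) (v : Fin 2 → ℂ), v ≠ 0 → B t v ≠ 0)
    (hc : Continuous fun q : unitInterval × (Fin 2 → ℂ) => B q.1 q.2) :
    ∃ H : unitInterval × ComplexProjectiveSpace 1 → ComplexProjectiveSpace 1, Continuous H ∧
      ∀ (t : unitInterval) (v : {v : Fin (1 + 1) → ℂ // v ≠ 0}), H (t, mk v) = mk ⟨B t v, hB t v v.2⟩ := by
  have hinj : ∀ t, Injective (B t) := fun t =>
    (injective_iff_map_eq_zero (B t)).2 fun v hv => by_contra fun hv0 => hB t v hv0 hv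
  refine ⟨fun q => Projectivization.map (B q.1) (hinj q.1) q.2, ?_, fun t v => rfl⟩
  rw [← isOpenQuotientMap_prodMap_mk.continuous_comp_iff]
  have hlift : Continuous fun q : unitInterval × {v : Fin (1 + 1) → ℂ // v ≠ 0} =>
      (⟨B q.1 q.2, hB q.1 q.2 q.2.2⟩ : {v : Fin (1 + 1) → ℂ // v ≠ 0}) :=
    (hc.comp (continuous_fst.prodMk (continuous_subtype_val.comp continuous_snd))).subtype_mk _
  exact continuous_mk.comp hlift

/-- **The identity of `ℂℙ¹` is homotopic to any projective transformation `[v] ↦ [A v]`**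
(`GL₂(ℂ)` is path connected): run the pencil `B t := γ t • A + (1 - γ t) • 1` along a path `γ`
from `0` to `1` in `ℂ` avoiding the finitely many singular parameters, and take
`H (t, [v]) := [B t v]`. [folklore] -/
theorem homotopic_id_projectiveMap (A : (Fin 2 → ℂ) ≃ₗ[ℂ] (Fin 2 → ℂ)) :
    ContinuousMap.Homotopic (ContinuousMap.id (ComplexProjectiveSpace 1))
      ⟨PlusOneSpherePair.projectiveMap A, PlusOneSpherePair.continuous_projectiveMap A⟩ := by
  obtain ⟨γ, hγ⟩ := exists_path_pencil_ne_zero A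
  -- the pencil along `γ`
  obtain ⟨B, hB⟩ : ∃ B : unitInterval → (Fin 2 → ℂ) →ₗ[ℂ] (Fin 2 → ℂ), ∀ t,
      B t = ((γ t : ℂ) • (A : (Fin 2 → ℂ) →ₗ[ℂ] (Fin 2 → ℂ)) + (1 - (γ t : ℂ)) • LinearMap.id :
        (Fin 2 → ℂ) →ₗ[ℂ] (Fin 2 → ℂ)) :=
    ⟨_, fun t => rfl⟩
  have hBv : ∀ (t : unitInterval) (v : Fin 2 → ℂ), B t v = (γ t : ℂ) • A v + (1 - (γ t : ℂ)) • v := by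
    intro t v
    simp [hB]
  have hBne : ∀ (t : unitInterval) (v : Fin 2 → ℂ), v ≠ 0 → B t v ≠ 0 := by
    intro t v hv
    rw [hB]; exact hγ t v hv
  have hAc : Continuous fun v : Fin 2 → ℂ => A v :=
    (A : (Fin 2 → ℂ) →ₗ[ℂ] (Fin 2 → ℂ)).continuous_of_finiteDimensional
  have hc : Continuous fun q : unitInterval × (Fin 2 → ℂ) => B q.1 q.2 := by
    simp only [hBv]
    have hγc : Continuous fun q : unitInterval × (Fin 2 → ℂ) => (γ q.1 : ℂ) :=
      γ.continuous.comp continuous_fst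
    exact (hγc.smul (hAc.comp continuous_snd)).add ((continuous_const.sub hγc).smul
      continuous_snd)
  obtain ⟨H, hHc, hHmk⟩ := exists_continuous_family_map hBne hc
  refine ⟨{ toFun := H, continuous_toFun := hHc, map_zero_left := ?_, map_one_left := ?_ }⟩
  · -- at `t = 0` the pencil is the identity
    intro p
    induction p using ComplexProjectiveSpace.ind with
    | h v =>
      rw [ContinuousMap.id_apply, hHmk]
      congr 1
      apply Subtype.ext
      simp [hBv]
  · -- at `t = 1` the pencil is `A`
    intro p
    induction p using ComplexProjectiveSpace.ind with
    | h v =>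
      rw [ContinuousMap.coe_mk, PlusOneSpherePair.projectiveMap_mk, hHmk]
      congr 1
      apply Subtype.ext
      simp [hBv]

end MoebiusHomotopic

open MoebiusHomotopic

/-- **Projective transformations of `ℂℙ¹` are homotopic to the identity** (registered stub
`helper_moebiusHomotopic` of line `cross-cap-laurent`, signature verbatim).  For
`A ∈ GL₂(ℂ)` the map `[v] ↦ [A v]` of `ℂℙ¹` is homotopic to `id`, since `GL₂(ℂ)` is path
connected: the pencil `s • A + (1 - s) • 1` is singular for at most finitely many `s ∈ ℂ`, and a
path from `0` to `1` in the (path connected) complement of this finite set gives the homotopy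
`(t, [v]) ↦ [(γ t • A + (1 - γ t) • 1) v]` (Griffiths–Harris, Ch. 0 §2; McDuff–Salamon 2012,
§4.2). [folklore] -/
theorem helper_moebiusHomotopic : ∀ (A : (Fin 2 → ℂ) ≃ₗ[ℂ] (Fin 2 → ℂ)), ContinuousMap.Homotopic ⟨PlusOneSpherePair.projectiveMap A, PlusOneSpherePair.continuous_projectiveMap A⟩ (ContinuousMap.id (ComplexProjectiveSpace 1)) :=
  fun A => (homotopic_id_projectiveMap A).symm

/-- **The chart swap is realised by a self-map of `ℂℙ¹` homotopic to the identity** (registered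
stub `helper_swapGlued` of line `cross-cap-laurent`, signature verbatim).  Let `F : ℂℙ¹ → X` be a
glued map of the two-chart pair `(u, v)`: `F [w₀ : w₁] = u (w₁ / w₀)` on `{w₀ ≠ 0}` and
`F [w₀ : w₁] = v (w₀ / w₁)` on `{w₁ ≠ 0}`.  With `σ [w₀ : w₁] := [w₁ : w₀]` the projective
transformation of the coordinate swap, `F ∘ σ` is a glued map of the swapped pair `(v, u)`:
for `w₀ ≠ 0` the point `σ [w] = [w₁ : w₀]` lies in the chart `{second coordinate ≠ 0}`, where
`F` reads `v (w₁ / w₀)`, and symmetrically for `w₁ ≠ 0`; and `σ` is homotopic to `id` by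
`helper_moebiusHomotopic`.  (The compatibility `v z = u z⁻¹` is part of the registered signature
but is not needed.) [folklore] -/
theorem helper_swapGlued : ∀ (X : Type) [TopologicalSpace X] (u v : ℂ → X) (F : C(ComplexProjectiveSpace 1, X)), (∀ z : ℂ, z ≠ 0 → v z = u z⁻¹) → (∀ p, CoordNeZero 0 p → F p = u (affineCoordComplex 0 p 0)) → (∀ p, CoordNeZero 1 p → F p = v (affineCoordComplex 1 p 0)) → ∃ σ : C(ComplexProjectiveSpace 1, ComplexProjectiveSpace 1), σ.Homotopic (ContinuousMap.id _) ∧ (∀ p, CoordNeZero 0 p → (F.comp σ) p = v (affineCoordComplex 0 p 0)) ∧ (∀ p, CoordNeZero 1 p → (F.comp σ) p = u (affineCoordComplex 1 p 0)) := by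
  intro X _ u v F _ h0 h1
  -- the coordinate swap `(w₀, w₁) ↦ (w₁, w₀)` of `ℂ²`
  set S : (Fin 2 → ℂ) ≃ₗ[ℂ] (Fin 2 → ℂ) := LinearEquiv.funCongrLeft ℂ ℂ (Equiv.swap 0 1) with hS
  have hS0 : ∀ w : Fin 2 → ℂ, S w 0 = w 1 := fun w => by
    simp [hS, LinearMap.funLeft_apply, Equiv.swap_apply_left]
  have hS1 : ∀ w : Fin 2 → ℂ, S w 1 = w 0 := fun w => by
    simp [hS, LinearMap.funLeft_apply, Equiv.swap_apply_right]
  have e0 : (0 : Fin 2).succAbove (0 : Fin 1) = 1 := by decide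
  have e1 : (1 : Fin 2).succAbove (0 : Fin 1) = 0 := by decide
  refine ⟨⟨PlusOneSpherePair.projectiveMap S, PlusOneSpherePair.continuous_projectiveMap S⟩,
    helper_moebiusHomotopic S, ?_, ?_⟩
  · -- on `{w₀ ≠ 0}`: `σ [w] = [w₁ : w₀]` lies in `{second coordinate ≠ 0}`, read `F` there
    intro p hp
    induction p using ComplexProjectiveSpace.ind with
    | h w =>
      have hw : (w : Fin 2 → ℂ) 0 ≠ 0 := hp
      show F (PlusOneSpherePair.projectiveMap S (mk w)) = _
      rw [PlusOneSpherePair.projectiveMap_mk, h1 _ (by simpa [hS1] using hw)]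
      simp only [affineCoordComplex_mk, e0, e1, hS0, hS1]
  · -- on `{w₁ ≠ 0}`: `σ [w] = [w₁ : w₀]` lies in `{first coordinate ≠ 0}`, read `F` there
    intro p hp
    induction p using ComplexProjectiveSpace.ind with
    | h w =>
      have hw : (w : Fin 2 → ℂ) 1 ≠ 0 := hp
      show F (PlusOneSpherePair.projectiveMap S (mk w)) = _
      rw [PlusOneSpherePair.projectiveMap_mk, h0 _ (by simpa [hS0] using hw)]
      simp only [affineCoordComplex_mk, e0, e1, hS0, hS1]

end Summit.SmoothPoincare4.SmoothPoincare4.Theorems.GromovRecognitionRelEnd.CrossCapLaurent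

end
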